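import Literature.MathematicalPhysics.QuantumFieldTheory.Balaban1983to89.B9Thm37CutoffGradTerms

/-!
# `Balaban1983to89.B9Thm37CutoffDivTerms` — T. Bałaban, *Propagators for lattice gauge theories in a background field*, Commun. Math. Phys. **99**
# (1985) 389–434 [Balaban1985BackgroundPropagators], Sect. C pp. 409–410: the RIGHT-ENTRY CUBE TERM `(h_□G′_□h_□)∇*_{U,μ}` of the expansion
# (3.87)∕(3.90), bounded POINTWISE over the gauge-invariant test class from the cube letter's (3.42) entries and the sizes of the cut-off `h_□`,
# and its localized block majorant — the `hTF μ` slot of `B9Thm37GpTorusRegularEntries` at one cube of the cover of record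

statement-level skeleton of published theorems with citation tags; proofs where landed; nothing here is a claim about the Yang–Mills mass gap

PDF held: `paper:balaban1985-cmp99-background-propagators` (journal page = PDF page + 388); pp. 397, 409–410, 413 read from the held text layer;
[4] = [Balaban1984PropagatorsII] pp. 230, 232, 234.

THE PRINT.  p. 409 (3.87) *«G′₀ = Σ_{□∈𝒟} h_□G′_□h_□»*; Theorem 3.7 p. 409: *«The expansion is convergent in all norms appearing in the inequalities
(3.42)–(3.47)»*; p. 410: *«Theorem 3.7 implies that all the inequalities (3.42)–(3.47) hold for G′»*; Thm 3.1 (3.42) p. 397, third member: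
*«|(G′(U)∇*_Uλ)(x)| ≤ B₀Lʲηe^{−δ₀d(y,y′)}|λ| for x ∈ Δ(y), y ∈ Λ_j, supp λ ⊂ Δ(y′)»*; p. 413 (3.100): *«(D_μhA)(x) = h(x)(D_μA)(x) + (∂_μh)(x)R(U(x,x+ηe_μ))A(x+ηe_μ)»*
(the lattice Leibniz rule of a covariant difference through a scalar cut-off; here along the backward bond, (3.8) p. 392 with (3.5) p. 391:
`(D*_μA)(x) = R(U(x−ηe_μ,x))⁻¹A(x−ηe_μ) − A(x)`); [4] (2.51)–(2.52) p. 232 (*«λ = Σ_{y′}Δ(y′)λ»*, a majorant piece by piece); [4] p. 230 (2.44): the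
commutator terms are `O(M⁻¹)` (our `|∂h_□| ≤ C1F∕(8∕5·S_j)`, p38's `B9Thm37CubeCoverCommutatorSizes.abs_hTY_shiftY_sub_le`).

WHY THIS FILE (cell context: G-B9-LETTERS, module M5.5 FILE 4b; consumer = FILE 4c `B9Thm37GpTorusRegularEntriesCubes`, which feeds the `hTF μ` slot of
FILE 2 `B9Thm37GpTorusRegularEntries.eBlock_kernelFamilySInv_Gp_of_cubes` at the cube cover of record; sibling of FILE 4a `B9Thm37CutoffGradTerms`, the
left-entry terms).  In def-Y's letters the backward difference letter is `∇_{inr μ} = −η⁻¹∇*_{V,μ}` (`B9Eq352GradLetters.diffLetter_inr`), so the cube term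
of the right entry `(η²G′)·∇_{inr μ}` reads `Λ ↦ −η·h_□·O(h_□·∇*_{V,μ}Λ)` for the cube letter `O` (= `G′_□(V)`).  For `O` with its (3.42) entries over the
invariant class DISPLAYED (`h342₀` — first member, `h342₂` — third member, the pointwise READ shapes of `B9CubeLettersInvReadDict` §3), the cut-off
`h_□ = hTY i c` of the partition of record and a test function `Λ` of the class of `f` (`supp f ⊂ Δ(βy′)`), we bound at `z ∈ Δ(βy)`:
* §1 (the Leibniz rule along the backward bond) `h(w)·(∇*_{V,μ}Λ)(w) = (∇*_{V,μ}(hΛ))(w) + (h(w) − h(w−e_μ))·R(U_μ(w−e_μ))⁻¹Λ(w−e_μ)`;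
* §2 ★★ `eta_norm_hOh_cdsS_le`: `η‖h_□(z)·O(h_□∇*_{V,μ}Λ)(z)‖ ≤ B₀(1 + m_N·e^{δ}·(5∕8)C1F∕M_h)·ℓ(y)·e^{−δd(y,y′)}·|f|` — the main term `O∇*_{V,μ}(h_□Λ)` by
  (3.42)₃ for `O` at `h_□Λ` (a member of the class), the remainder `g(w) = (h_□(w) − h_□(w−e_μ))·R(U_μ(w−e_μ))⁻¹Λ(w−e_μ)` split INPUT-SIDE into its block
  pieces `g = Σ_{a : d(a,y′) ≤ 1} 1_{Δ(βa)}g` ([4] (2.51)–(2.52); `Λ(w−e_μ) ≠ 0` puts `Δ(w)` within one bond of `Δ(βy′)`), each piece a member of the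
  class of the profile `κ₁·|f(·−e_μ)|·1_{Δ(βa)}` (`κ₁ = C1F∕(8∕5·S_j) ≥ |∂h_□|`, bi-contractive bond variables) and bounded by (3.42)₁ for `O`:
  `η⁻¹·B₀ℓ(y)²e^{−δd(y,a)}·κ₁|f| ≤ e^{δ}·B₀ℓ(y)·(κ₁L^{lev z})·e^{−δd(y,y′)}|f|` with `κ₁L^{lev z} ≤ (5∕8)C1F∕M_h` because the outer factor `h_□(z) ≠ 0`
  forces `lev z ≤ j + 1` («O(M⁻¹)», [4] (2.44)); `m_N` bounds the number of index bonds within distance `1` of a bond (displayed: `T`, `hT`, `hnbr`);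
* the term vanishes unless `h_□(z) ≠ 0`, whence `Δ(z) ∈ QT □`, and §3 turns the bound into the LOCALIZED BLOCK MAJORANT
  `1_{S}(a)·M₂(Σ_j‖b_j‖)·B₀(1 + m_N e^{δ}(5∕8)C1F∕M_h)·ℓ(a)·e^{−δd(a,a′)}` of the conjugated operator `conj b Rl`, `Rl Λ = −η·h_□O(h_□∇*_{V,μ}Λ)`
  (def-Y's `hasMajorant_conj_of_ball_bound`) — the shape `KF μ □` of FILE 2.
Nothing of (3.42) for the cube letter, of the sizes of `h_□`, of the neighbourhood count or of Theorem 3.7 is asserted: all displayed or cited by name;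
corner-free members (`ιB` a section of `β`), `η = |c_f|⁻¹`, bi-contractive bond variables, `0 ≤ δ`, as in the sibling modules.

WHAT IS PROVED (all `theorem`s, no `sorry`).  §1 `cutMulY_cdsS_eq`, `mem_QT_of_cutMulY_ne_zero`, `norm_R_inv_le`; §2 ★★ `eta_norm_hOh_cdsS_le`;
§3 `smul_comm_of_eq_div`, ★★ `hasMajorant_conj_divTerm`.
-/

noncomputable section

namespace Literature.MathematicalPhysics.QuantumFieldTheory.Balaban1983to89.B9Thm37CutoffDivTerms

open Node00
open B9Thm37CubeCoverCommutators
open B9Thm37CubeCoverCommutatorSizes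
open B9Thm37CubeCoverCommutatorSizesGrad
open B9Thm37CommutatorBound389 (norm_cutMulY_le_of_le lev_le_succ_of_touch torusSupNorm_sub_shiftY_le_one dist_blkOf_le_one_of_touch
  geo9K_dist_eq geo9K_len_eq levY_eq_lvl_of_blkOf_eq)
open B9Thm37CommutatorBound389Majorant (norm_liftY_le)
open B9Thm37CutoffGradTerms (mem_QT_and_lev_of_near torusSupNorm_sub_self_le_one len_eq_pow_mul_eta)
open B6KLevelCensusIndexV1 (KIdx)
open B6Ineq2142KLevelV1 (β lvl)
open B4TorusKernel.MultiPeriod (torusSupNorm)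
open B6MultiLevelBoxOperator (bigSide bigSide_eq one_le_bigSide)
open B6Geom246MultiLevelBox (bset blkOf)
open B6Geom246MultiLevelTorus (bondT connectedT)
open B6Cover236MultiLevelBlocks (cubes)
open B6Partition118KLevelTorus (hT abs_hT_le_one)
open B6Partition118KLevelTorusCentral (QT)
open B6Partition118KLevelFineSizes (C1F C1F_nonneg)
open B6RandomWalk (HasMajorant hasMajorant_mono)
open B9Thm34Ext (toB6)
open B9GeoNormsKLevelV1 (geo9K geo9K_supNorm_nonneg)
open B9GeoLemma21KLevelV1 (geo9K_dist_triangle)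
open B9Ineq349SiteComposite (etaS_pos)
open B9Eq352DivFormLetters (conj)
open B9Eq39Adjoint (R R_smul)
open B9Eq310Hermitian (norm_R_le)
open scoped Matrix

variable {𝔸 : Type} [NormedRing 𝔸] [NormedAlgebra ℂ 𝔸] [CompleteSpace 𝔸]
variable {d ℓ : ℕ} {hd : 1 ≤ d + 1} {hL : Odd (ℓ + 1) ∧ 1 < ℓ + 1} {b₀ b₁ : ℝ}
variable {ι : Type} [Fintype ι]
variable (i : KIdx d ℓ hd hL b₀ b₁) (b : Module.Basis ι ℝ 𝔸)

/-! ## §1 The Leibniz rule of `∇*_{V,μ}` through a scalar cut-off, output localisation, the transported neighbour value -/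

section Leibniz

variable (V : CfgY 𝔸 i)

/-- **(3.100) ALONG THE BACKWARD BOND, IN def-Y's LETTERS**: `h(w)·(∇*_{V,μ}Λ)(w) = (∇*_{V,μ}(hΛ))(w) + (h(w) − h(w−e_μ))·R(U_μ(w−e_μ))⁻¹Λ(w−e_μ)`
(`(∇*_{V,μ}Ψ)(w) = R(U_μ(w−e_μ))⁻¹Ψ(w−e_μ) − Ψ(w)` at `η = 1`). [cite: Balaban1985BackgroundPropagators, (3.100) p.413, (3.8) p.392, (3.5) p.391] -/
theorem cutMulY_cdsS_eq (μ : Fin (d + 1)) (h : SiteY i → ℝ) (Λ : SiteY i → 𝔸) (w : SiteY i) :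
    cutMulY h (cdsS i V μ Λ) w = cdsS i V μ (cutMulY h Λ) w
      + (((h w - h ((shiftY i μ).symm w) : ℝ)) : ℂ) • R (UboxY i V μ ((shiftY i μ).symm w))⁻¹ (Λ ((shiftY i μ).symm w)) := by
  have e : ∀ Ψ : SiteY i → 𝔸,
      cdsS i V μ Ψ w = R (UboxY i V μ ((shiftY i μ).symm w))⁻¹ (Ψ ((shiftY i μ).symm w)) - Ψ w := fun Ψ => rfl
  rw [cutMulY_apply, e, e, cutMulY_apply, cutMulY_apply, R_smul, Complex.ofReal_sub, sub_smul, smul_sub]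
  abel

omit [CompleteSpace 𝔸] in
/-- **OUTPUT LOCALISATION OF A TERM CARRYING THE FACTOR `h_□(z)`**: `h_□(z)·Ψ(z) ≠ 0 ⟹ Δ(z) ∈ QT □` and `lev z ≤ j + 1`.
[cite: Balaban1985BackgroundPropagators, (3.87) p.409, (3.91) p.410; Balaban1984PropagatorsII, p.235] -/
theorem mem_QT_of_cutMulY_ne_zero (c : ↥(cubes i.D.toDomains)) (Ψ : SiteY i → 𝔸) (z : SiteY i) (hz : cutMulY (hTY i c) Ψ z ≠ 0) :
    blkOf i.D.toDomains z ∈ QT i.D (B9GeoLemma21KLevelV1.one_le_Mh i) (four_le_P' i) c ∧ levY i z ≤ c.1.1 + 1 := by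
  by_cases h0 : hTY i c z = 0
  · exact absurd (by rw [cutMulY_apply, h0, Complex.ofReal_zero, zero_smul]) hz
  · exact mem_QT_and_lev_of_near i c (z := z) (u' := z) h0 (torusSupNorm_sub_self_le_one i z)

/-- at bi-contractive bond variables the transported value is not larger: `‖R(U_μ(w′))⁻¹X‖ ≤ ‖X‖`.
[cite: Balaban1985BackgroundPropagators, (3.5) p.391, (3.8) p.392 (R(U) norm-preserving at unitary U), bookkeeping] -/
theorem norm_R_inv_le
    (hV : ∀ (μ : Fin (d + 1)) (x : SiteY i), ‖(UboxY i V μ x : 𝔸)‖ ≤ 1 ∧ ‖(((UboxY i V μ x)⁻¹ : 𝔸ˣ) : 𝔸)‖ ≤ 1)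
    (μ : Fin (d + 1)) (w' : SiteY i) (X : 𝔸) : ‖R (UboxY i V μ w')⁻¹ X‖ ≤ ‖X‖ := by
  refine norm_R_le (hV μ w').2 ?_ X
  rw [inv_inv]
  exact (hV μ w').1

end Leibniz

/-! ## §2 The right-entry cube term, pointwise over the class: main term by (3.42)₃, the remainder split input-side over the blocks near `y′` -/

section Div

variable (V : CfgY 𝔸 i) (O : (SiteY i → 𝔸) →ₗ[ℂ] (SiteY i → 𝔸)) {B₀ δ : ℝ}

/-- ★★ **THE RIGHT-ENTRY CUBE TERM `h_□G′_□h_□∇*_{U,μ}`, POINTWISE OVER THE CLASS**: for a cube letter `O` with (3.42)₁,₃ displayed over the invariant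
class, the cut-off `h_□` of the partition of record, `η = |c_f|⁻¹`, `0 ≤ δ`, bi-contractive bond variables and at most `m_N` index bonds within distance
`1` of any bond (`T`, `hT`, `hnbr`): `η‖h_□(z)·O(h_□∇*_{V,μ}Λ)(z)‖ ≤ B₀(1 + m_N·e^{δ}·(5∕8)C1F∕M_h)·ℓ(y)·e^{−δd(y,y′)}·|f|` for `z ∈ Δ(βy)`, `‖Λ‖ ≤ |f|`,
`supp f ⊂ Δ(βy′)` — (3.100) along the backward bond; the main term `O∇*_{V,μ}(h_□Λ)` by (3.42)₃; the remainder `(∂⁻_μh_□)·R(U)⁻¹Λ(·−e_μ)` split into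
its block pieces over the blocks within `1` of `βy′` ([4] (2.51)–(2.52)), each bounded by (3.42)₁ at the cost `|∂h_□|·η⁻¹·B₀ℓ(y)² ≤ (5∕8)(C1F∕M_h)·B₀ℓ(y)`
because `ℓ(y)∕η = L^{lev z} ≤ L^{j+1}` on `supp h_□` («O(M⁻¹)», [4] (2.44)), and `e^{−δd(y,a)} ≤ e^{δ}e^{−δd(y,y′)}` for `d(a,y′) ≤ 1`.
[cite: Balaban1985BackgroundPropagators, (3.87)–(3.90) pp.409–410, (3.100) p.413, (3.42) p.397 (first and third members); Balaban1984PropagatorsII, (2.44) p.230, (2.51)–(2.52) p.232, p.234] -/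
theorem eta_norm_hOh_cdsS_le (c : ↥(cubes i.D.toDomains)) (hB₀ : 0 ≤ B₀) (hδ : 0 ≤ δ) (hη : etaS i = |i.cf|⁻¹)
    (ιB : BlkY i → IBondY i) (hι : ∀ s, β i.hN i.D i.hk (ιB s) = s)
    (hV : ∀ (μ : Fin (d + 1)) (x : SiteY i), ‖(UboxY i V μ x : 𝔸)‖ ≤ 1 ∧ ‖(((UboxY i V μ x)⁻¹ : 𝔸ˣ) : 𝔸)‖ ≤ 1)
    (h342₀ : ∀ (f : SiteY i → ℝ) (y y' : IBondY i), (geo9K i).suppIn (Sum.inl f) y' →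
      ∀ Λ : SiteY i → 𝔸, (∀ z, ‖Λ z‖ ≤ |f z|) → ∀ z : SiteY i, blkOf i.D.toDomains z = β i.hN i.D i.hk y →
        etaS i ^ 2 * ‖O Λ z‖ ≤ B₀ * (geo9K i).len y ^ 2 * Real.exp (-(δ * (geo9K i).dist y y')) * (geo9K i).supNorm (Sum.inl f))
    (h342₂ : ∀ (f : SiteY i → ℝ) (y y' : IBondY i), (geo9K i).suppIn (Sum.inl f) y' →
      ∀ Λ : SiteY i → 𝔸, (∀ z, ‖Λ z‖ ≤ |f z|) → ∀ (z : SiteY i) (μ : Fin (d + 1)), blkOf i.D.toDomains z = β i.hN i.D i.hk y →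
        etaS i * ‖O (cdsS i V μ Λ) z‖ ≤ B₀ * (geo9K i).len y * Real.exp (-(δ * (geo9K i).dist y y')) * (geo9K i).supNorm (Sum.inl f))
    (T : IBondY i → Finset (IBondY i)) (hT : ∀ a y' : IBondY i, (geo9K i).dist a y' ≤ 1 → a ∈ T y')
    {mN : ℕ} (hnbr : ∀ y' : IBondY i, (T y').card ≤ mN)
    (f : SiteY i → ℝ) (y y' : IBondY i) (hs : (geo9K i).suppIn (Sum.inl f) y')
    (Λ : SiteY i → 𝔸) (hΛ : ∀ z, ‖Λ z‖ ≤ |f z|) (z : SiteY i) (μ : Fin (d + 1)) (hz : blkOf i.D.toDomains z = β i.hN i.D i.hk y) :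
    etaS i * ‖cutMulY (hTY i c) (O (cutMulY (hTY i c) (cdsS i V μ Λ))) z‖
      ≤ B₀ * (1 + (mN : ℝ) * Real.exp δ * (5 / 8 * C1F d ℓ / i.Mh)) * (geo9K i).len y * Real.exp (-(δ * (geo9K i).dist y y'))
          * (geo9K i).supNorm (Sum.inl f) := by
  classical
  obtain ⟨_, hMh2, _, _⟩ := side_conditions i
  have hη0 : 0 < etaS i := etaS_pos i
  have hηne : etaS i ≠ 0 := hη0.ne'
  have hL1 : (1 : ℝ) ≤ (ℓ : ℝ) + 1 := by linarith [(Nat.cast_nonneg ℓ : (0 : ℝ) ≤ ℓ)]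
  have hM : (0 : ℝ) < i.Mh := by exact_mod_cast (lt_of_lt_of_le (by norm_num) hMh2)
  have hE0 : 0 ≤ Real.exp (-(δ * (geo9K i).dist y y')) := (Real.exp_pos _).le
  have hF0 : 0 ≤ (geo9K i).supNorm (Sum.inl f) := geo9K_supNorm_nonneg i _
  have hleny : 0 ≤ (geo9K i).len y := (B6KLevelCensusIndexV1.len_pos i y).le
  have hC : 0 ≤ C1F d ℓ := C1F_nonneg d ℓ
  have hRHS : 0 ≤ B₀ * (1 + (mN : ℝ) * Real.exp δ * (5 / 8 * C1F d ℓ / i.Mh)) * (geo9K i).len y * Real.exp (-(δ * (geo9K i).dist y y'))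
      * (geo9K i).supNorm (Sum.inl f) := by positivity
  set h : SiteY i → ℝ := hTY i c with hh
  -- output localisation: the term carries the factor `h_□(z)`
  by_cases hz0 : h z = 0
  · rw [cutMulY_apply, hz0, Complex.ofReal_zero, zero_smul, norm_zero, mul_zero]; exact hRHS
  have hnear : levY i z ≤ c.1.1 + 1 := (mem_QT_and_lev_of_near i c (z := z) (u' := z) hz0 (torusSupNorm_sub_self_le_one i z)).2
  have hh1 : ∀ w, |h w| ≤ 1 := fun w => abs_hT_le_one i.D (B9GeoLemma21KLevelV1.one_le_Mh i) (B9GeoLemma21KLevelV1.one_le_P i) c w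
  have hΛ' : ∀ w, ‖cutMulY h Λ w‖ ≤ |f w| := norm_cutMulY_le_of_le hh1 hΛ
  -- the bond coefficient `κ₁ ≥ |∂h_□|` and its level-uniform form `κ₁·L^{lev z} ≤ (5/8)·C1F/M_h`
  set κ₁ : ℝ := C1F d ℓ / (8 / 5 * (bigSide ℓ i.Mh c.1.1 : ℝ)) with hκ₁
  have hκ0 : 0 ≤ κ₁ := le_trans (abs_nonneg _) (abs_hTY_shiftY_sub_le i c μ z)
  have hlen : (geo9K i).len y = ((ℓ : ℝ) + 1) ^ levY i z * etaS i := len_eq_pow_mul_eta i hη hz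
  have hκpow : κ₁ * ((ℓ : ℝ) + 1) ^ levY i z ≤ 5 / 8 * C1F d ℓ / i.Mh := by
    rw [hκ₁, C1F_div_bigSide_eq i c.1.1]
    have hLj : (0 : ℝ) < ((ℓ : ℝ) + 1) ^ c.1.1 := pow_pos (by linarith) _
    have hq : (((ℓ : ℝ) + 1) ^ c.1.1)⁻¹ * ((ℓ : ℝ) + 1) ^ levY i z ≤ (ℓ : ℝ) + 1 := by
      rw [inv_mul_le_iff₀ hLj]
      calc ((ℓ : ℝ) + 1) ^ levY i z ≤ ((ℓ : ℝ) + 1) ^ (c.1.1 + 1) := pow_le_pow_right₀ hL1 hnear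
        _ = ((ℓ : ℝ) + 1) ^ c.1.1 * ((ℓ : ℝ) + 1) := pow_succ _ _
    calc 5 / 8 * C1F d ℓ / (((ℓ : ℝ) + 1) * i.Mh) * (((ℓ : ℝ) + 1) ^ c.1.1)⁻¹ * ((ℓ : ℝ) + 1) ^ levY i z
        = 5 / 8 * C1F d ℓ / (((ℓ : ℝ) + 1) * i.Mh) * ((((ℓ : ℝ) + 1) ^ c.1.1)⁻¹ * ((ℓ : ℝ) + 1) ^ levY i z) := by ring
      _ ≤ 5 / 8 * C1F d ℓ / (((ℓ : ℝ) + 1) * i.Mh) * ((ℓ : ℝ) + 1) := mul_le_mul_of_nonneg_left hq (by positivity)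
      _ = 5 / 8 * C1F d ℓ / i.Mh := by field_simp
  -- the remainder of the Leibniz rule, its block pieces and their profiles
  set g : SiteY i → 𝔸 := fun w =>
    (((h w - h ((shiftY i μ).symm w) : ℝ)) : ℂ) • R (UboxY i V μ ((shiftY i μ).symm w))⁻¹ (Λ ((shiftY i μ).symm w)) with hg
  set gp : IBondY i → SiteY i → 𝔸 := fun a w => if ιB (blkOf i.D.toDomains w) = a then g w else 0 with hgp
  set fp : IBondY i → SiteY i → ℝ := fun a w => if ιB (blkOf i.D.toDomains w) = a then κ₁ * |f ((shiftY i μ).symm w)| else 0 with hfp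
  -- (i) the size of the remainder: `‖g(w)‖ ≤ κ₁·|f(w − e_μ)|`
  have hgle : ∀ w, ‖g w‖ ≤ κ₁ * |f ((shiftY i μ).symm w)| := fun w => by
    have hκ := abs_hTY_shiftY_sub_le i c μ ((shiftY i μ).symm w)
    rw [Equiv.apply_symm_apply] at hκ
    have hR := norm_R_inv_le i V hV μ ((shiftY i μ).symm w) (Λ ((shiftY i μ).symm w))
    show ‖(((h w - h ((shiftY i μ).symm w) : ℝ)) : ℂ) • R (UboxY i V μ ((shiftY i μ).symm w))⁻¹ (Λ ((shiftY i μ).symm w))‖ ≤ _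
    rw [norm_ofReal_smul]
    exact mul_le_mul hκ (hR.trans (hΛ _)) (norm_nonneg _) hκ0
  -- (ii) where the remainder is non-zero the block is within `1` of `βy′`
  have hdist1 : ∀ w, g w ≠ 0 → (geo9K i).dist (ιB (blkOf i.D.toDomains w)) y' ≤ 1 := fun w hw => by
    have hf : f ((shiftY i μ).symm w) ≠ 0 := fun h0 =>
      hw (norm_le_zero_iff.1 ((hgle w).trans (by rw [h0, abs_zero, mul_zero])))
    have hblk : blkOf i.D.toDomains ((shiftY i μ).symm w) = β i.hN i.D i.hk y' := hs _ hf
    rw [geo9K_dist_eq, hι, ← hblk]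
    exact_mod_cast dist_blkOf_le_one_of_touch i (torusSupNorm_sub_shiftY_le_one i μ w).2
  have hmemT : ∀ w, g w ≠ 0 → ιB (blkOf i.D.toDomains w) ∈ T y' := fun w hw => hT _ _ (hdist1 w hw)
  -- (iii) the remainder is the sum of its pieces over `T y′`
  have hsplit : g = ∑ a ∈ T y', gp a := by
    funext w
    rw [Finset.sum_apply]
    show g w = ∑ a ∈ T y', (if ιB (blkOf i.D.toDomains w) = a then g w else 0)
    by_cases hw : g w = 0
    · rw [hw]; symm
      exact Finset.sum_eq_zero fun a _ => ite_self 0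
    · rw [Finset.sum_ite_eq, if_pos (hmemT w hw)]
  -- (iv) the Leibniz split under `O`
  have hfun : cutMulY h (cdsS i V μ Λ) = cdsS i V μ (cutMulY h Λ) + g := by
    funext w; rw [Pi.add_apply]; exact cutMulY_cdsS_eq i V μ h Λ w
  have hO : O (cutMulY h (cdsS i V μ Λ)) z = O (cdsS i V μ (cutMulY h Λ)) z + ∑ a ∈ T y', O (gp a) z := by
    rw [hfun, map_add, Pi.add_apply, hsplit, map_sum, Finset.sum_apply]
  -- (v) each piece: (3.42)₁ for `O` at the block `a`, the profile `κ₁|f(· − e_μ)|1_{Δ(βa)}`; far pieces vanish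
  have hpiece : ∀ a ∈ T y', etaS i ^ 2 * ‖O (gp a) z‖
      ≤ B₀ * (((ℓ : ℝ) + 1) ^ levY i z * etaS i) ^ 2 * (Real.exp δ * Real.exp (-(δ * (geo9K i).dist y y')))
          * (κ₁ * (geo9K i).supNorm (Sum.inl f)) := by
    intro a _
    by_cases ha : (geo9K i).dist a y' ≤ 1
    · have hcls : ∀ w, ‖gp a w‖ ≤ |fp a w| := fun w => by
        show ‖(if ιB (blkOf i.D.toDomains w) = a then g w else 0)‖
          ≤ |(if ιB (blkOf i.D.toDomains w) = a then κ₁ * |f ((shiftY i μ).symm w)| else 0)|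
        split_ifs
        · exact (hgle w).trans (le_abs_self _)
        · rw [norm_zero, abs_zero]
      have hsa : (geo9K i).suppIn (Sum.inl (fp a)) a := by
        intro w hw
        have hwa : ιB (blkOf i.D.toDomains w) = a := by
          by_contra hne
          exact hw (show (if ιB (blkOf i.D.toDomains w) = a then κ₁ * |f ((shiftY i μ).symm w)| else 0) = 0 by rw [if_neg hne])
        show blkOf i.D.toDomains w = β i.hN i.D i.hk a
        rw [← hwa, hι]
      have hsup : (geo9K i).supNorm (Sum.inl (fp a)) ≤ κ₁ * (geo9K i).supNorm (Sum.inl f) := by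
        refine Real.iSup_le (fun w => ?_) (mul_nonneg hκ0 hF0)
        show |(if ιB (blkOf i.D.toDomains w) = a then κ₁ * |f ((shiftY i μ).symm w)| else 0)| ≤ _
        split_ifs
        · rw [abs_of_nonneg (mul_nonneg hκ0 (abs_nonneg _))]
          exact mul_le_mul_of_nonneg_left (OpsYRead342.abs_le_supNorm_inl i f _) hκ0
        · rw [abs_zero]; exact mul_nonneg hκ0 hF0
      have h1 := h342₀ (fp a) y a hsa (gp a) hcls z hz
      rw [hlen] at h1
      have hexp : Real.exp (-(δ * (geo9K i).dist y a)) ≤ Real.exp δ * Real.exp (-(δ * (geo9K i).dist y y')) := by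
        rw [← Real.exp_add]
        refine Real.exp_le_exp.2 ?_
        have htri := geo9K_dist_triangle i y a y'
        have h2 : δ * (geo9K i).dist y y' ≤ δ * ((geo9K i).dist y a + 1) :=
          mul_le_mul_of_nonneg_left (htri.trans (by linarith)) hδ
        linarith
      have hX : 0 ≤ B₀ * (((ℓ : ℝ) + 1) ^ levY i z * etaS i) ^ 2 := by positivity
      calc etaS i ^ 2 * ‖O (gp a) z‖ ≤ _ := h1
        _ ≤ _ := mul_le_mul (mul_le_mul_of_nonneg_left hexp hX) hsup (geo9K_supNorm_nonneg i _) (by positivity)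
    · have h0 : gp a = 0 := by
        funext w
        show (if ιB (blkOf i.D.toDomains w) = a then g w else 0) = 0
        split_ifs with hwa
        · by_contra hne
          have h1 := hdist1 w hne
          rw [hwa] at h1
          exact ha h1
        · rfl
      rw [h0, map_zero, Pi.zero_apply, norm_zero, mul_zero]; positivity
  -- (vi) the remainder summed: at most `m_N` pieces
  have hrem : etaS i ^ 2 * ‖∑ a ∈ T y', O (gp a) z‖
      ≤ (mN : ℝ) * (B₀ * (((ℓ : ℝ) + 1) ^ levY i z * etaS i) ^ 2 * (Real.exp δ * Real.exp (-(δ * (geo9K i).dist y y')))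
          * (κ₁ * (geo9K i).supNorm (Sum.inl f))) := by
    have hP0 : 0 ≤ B₀ * (((ℓ : ℝ) + 1) ^ levY i z * etaS i) ^ 2 * (Real.exp δ * Real.exp (-(δ * (geo9K i).dist y y')))
        * (κ₁ * (geo9K i).supNorm (Sum.inl f)) := by positivity
    calc etaS i ^ 2 * ‖∑ a ∈ T y', O (gp a) z‖ ≤ etaS i ^ 2 * ∑ a ∈ T y', ‖O (gp a) z‖ :=
          mul_le_mul_of_nonneg_left (norm_sum_le _ _) (sq_nonneg _)
      _ = ∑ a ∈ T y', etaS i ^ 2 * ‖O (gp a) z‖ := Finset.mul_sum _ _ _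
      _ ≤ ∑ a ∈ T y', B₀ * (((ℓ : ℝ) + 1) ^ levY i z * etaS i) ^ 2 * (Real.exp δ * Real.exp (-(δ * (geo9K i).dist y y')))
          * (κ₁ * (geo9K i).supNorm (Sum.inl f)) := Finset.sum_le_sum hpiece
      _ = ((T y').card : ℝ) * (B₀ * (((ℓ : ℝ) + 1) ^ levY i z * etaS i) ^ 2 * (Real.exp δ * Real.exp (-(δ * (geo9K i).dist y y')))
          * (κ₁ * (geo9K i).supNorm (Sum.inl f))) := by rw [Finset.sum_const, nsmul_eq_mul]
      _ ≤ _ := mul_le_mul_of_nonneg_right (Nat.cast_le.2 (hnbr y')) hP0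
  -- (vii) assemble: the outer factor `|h_□(z)| ≤ 1`, the main term by (3.42)₃ at `h_□Λ`, the remainder
  have hA : etaS i * ‖O (cdsS i V μ (cutMulY h Λ)) z‖
      ≤ B₀ * (geo9K i).len y * Real.exp (-(δ * (geo9K i).dist y y')) * (geo9K i).supNorm (Sum.inl f) :=
    h342₂ f y y' hs (cutMulY h Λ) hΛ' z μ hz
  have hB : etaS i * ‖∑ a ∈ T y', O (gp a) z‖
      ≤ (etaS i)⁻¹ * ((mN : ℝ) * (B₀ * (((ℓ : ℝ) + 1) ^ levY i z * etaS i) ^ 2 * (Real.exp δ * Real.exp (-(δ * (geo9K i).dist y y')))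
          * (κ₁ * (geo9K i).supNorm (Sum.inl f)))) := by
    rw [le_inv_mul_iff₀ hη0, ← mul_assoc, ← pow_two]
    exact hrem
  rw [cutMulY_apply, norm_ofReal_smul, hO]
  calc etaS i * (|h z| * ‖O (cdsS i V μ (cutMulY h Λ)) z + ∑ a ∈ T y', O (gp a) z‖)
      ≤ etaS i * (1 * (‖O (cdsS i V μ (cutMulY h Λ)) z‖ + ‖∑ a ∈ T y', O (gp a) z‖)) :=
        mul_le_mul_of_nonneg_left (mul_le_mul (hh1 z) (norm_add_le _ _) (norm_nonneg _) zero_le_one) hη0.le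
    _ = etaS i * ‖O (cdsS i V μ (cutMulY h Λ)) z‖ + etaS i * ‖∑ a ∈ T y', O (gp a) z‖ := by ring
    _ ≤ B₀ * (geo9K i).len y * Real.exp (-(δ * (geo9K i).dist y y')) * (geo9K i).supNorm (Sum.inl f)
          + (etaS i)⁻¹ * ((mN : ℝ) * (B₀ * (((ℓ : ℝ) + 1) ^ levY i z * etaS i) ^ 2
              * (Real.exp δ * Real.exp (-(δ * (geo9K i).dist y y'))) * (κ₁ * (geo9K i).supNorm (Sum.inl f)))) := add_le_add hA hB
    _ = B₀ * (1 + (mN : ℝ) * Real.exp δ * (κ₁ * ((ℓ : ℝ) + 1) ^ levY i z)) * (((ℓ : ℝ) + 1) ^ levY i z * etaS i)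
          * Real.exp (-(δ * (geo9K i).dist y y')) * (geo9K i).supNorm (Sum.inl f) := by
        rw [hlen]
        field_simp
    _ ≤ B₀ * (1 + (mN : ℝ) * Real.exp δ * (5 / 8 * C1F d ℓ / i.Mh)) * (((ℓ : ℝ) + 1) ^ levY i z * etaS i)
          * Real.exp (-(δ * (geo9K i).dist y y')) * (geo9K i).supNorm (Sum.inl f) := by
        have h3 : 0 ≤ (((ℓ : ℝ) + 1) ^ levY i z * etaS i) := by positivity
        refine mul_le_mul_of_nonneg_right (mul_le_mul_of_nonneg_right (mul_le_mul_of_nonneg_right ?_ h3) hE0) hF0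
        refine mul_le_mul_of_nonneg_left ?_ hB₀
        have h4 : 0 ≤ (mN : ℝ) * Real.exp δ := by positivity
        have h5 := mul_le_mul_of_nonneg_left hκpow h4
        linarith
    _ = _ := by rw [← hlen]

end Div

/-! ## §3 The localized block majorant of the conjugated right-entry term: the `KF μ □` slot of FILE 2 -/

section Majorants

variable (V : CfgY 𝔸 i) (O : (SiteY i → 𝔸) →ₗ[ℂ] (SiteY i → 𝔸)) {B₀ δ : ℝ}
variable [Fintype (geo9K i).Site] {Rr : ℝ} {Hp : Prop}

omit [Fintype (geo9K i).Site] in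
/-- an ℝ-linear `Rl` agreeing with `Λ ↦ −η·h_□O(h_□∇*_{V,μ}Λ)` is ℂ-homogeneous. [cite: Balaban1985BackgroundPropagators, (3.87) p.409, bookkeeping] -/
theorem smul_comm_of_eq_div (c : ↥(cubes i.D.toDomains)) (μ : Fin (d + 1)) (Rl : Module.End ℝ (SiteY i → 𝔸))
    (hRl : ∀ Λ z, Rl Λ z = -((((etaS i : ℝ)) : ℂ) • cutMulY (hTY i c) (O (cutMulY (hTY i c) (cdsS i V μ Λ))) z))
    (a : ℂ) (Λ : SiteY i → 𝔸) : Rl (a • Λ) = a • Rl Λ := by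
  funext z
  rw [hRl, Pi.smul_apply, hRl, cdsS_smul, map_smul, map_smul, map_smul, Pi.smul_apply, smul_comm, smul_neg]

/-- ★★ **THE `KF μ □` SLOT OF FILE 2: the localized block majorant of the conjugated right-entry term** — for a cube letter `O` with (3.42)₁,₃ displayed
over the class, bi-contractive bond variables, `0 ≤ δ`, at most `m_N` index bonds within `1` of a bond, an ℝ-linear `Rl` with `Rl Λ = −η·h_□O(h_□∇*_{V,μ}Λ)`,
a real basis `b` (coordinate bound `M₂`), a corner-free member and ANY `S ⊇ {a : βa ∈ QT □}`: `conj b Rl` has the majorant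
`1[a ∈ S]·M₂(Σ_j‖b_j‖)·B₀(1 + m_N e^{δ}(5∕8)C1F∕M_h)·ℓ(a)·e^{−δd(a,a′)}` (off `S` the term vanishes on the block).
[cite: Balaban1985BackgroundPropagators, (3.87)–(3.90) pp.409–410, (3.42)₃ p.397; Balaban1984PropagatorsII, (2.51) p.232, p.234] -/
theorem hasMajorant_conj_divTerm (c : ↥(cubes i.D.toDomains)) (μ : Fin (d + 1)) (hB₀ : 0 ≤ B₀) (hδ : 0 ≤ δ) (hη : etaS i = |i.cf|⁻¹)
    (ιB : BlkY i → IBondY i) (hι : ∀ s, β i.hN i.D i.hk (ιB s) = s)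
    (hV : ∀ (μ : Fin (d + 1)) (x : SiteY i), ‖(UboxY i V μ x : 𝔸)‖ ≤ 1 ∧ ‖(((UboxY i V μ x)⁻¹ : 𝔸ˣ) : 𝔸)‖ ≤ 1)
    (h342₀ : ∀ (f : SiteY i → ℝ) (y y' : IBondY i), (geo9K i).suppIn (Sum.inl f) y' →
      ∀ Λ : SiteY i → 𝔸, (∀ z, ‖Λ z‖ ≤ |f z|) → ∀ z : SiteY i, blkOf i.D.toDomains z = β i.hN i.D i.hk y →
        etaS i ^ 2 * ‖O Λ z‖ ≤ B₀ * (geo9K i).len y ^ 2 * Real.exp (-(δ * (geo9K i).dist y y')) * (geo9K i).supNorm (Sum.inl f))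
    (h342₂ : ∀ (f : SiteY i → ℝ) (y y' : IBondY i), (geo9K i).suppIn (Sum.inl f) y' →
      ∀ Λ : SiteY i → 𝔸, (∀ z, ‖Λ z‖ ≤ |f z|) → ∀ (z : SiteY i) (μ : Fin (d + 1)), blkOf i.D.toDomains z = β i.hN i.D i.hk y →
        etaS i * ‖O (cdsS i V μ Λ) z‖ ≤ B₀ * (geo9K i).len y * Real.exp (-(δ * (geo9K i).dist y y')) * (geo9K i).supNorm (Sum.inl f))
    (T : IBondY i → Finset (IBondY i)) (hT : ∀ a y' : IBondY i, (geo9K i).dist a y' ≤ 1 → a ∈ T y')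
    {mN : ℕ} (hnbr : ∀ y' : IBondY i, (T y').card ≤ mN)
    {M₂ : ℝ} (hM₂ : 0 ≤ M₂) (hrepr : ∀ (v : 𝔸) (j : ι), |b.repr v j| ≤ M₂ * ‖v‖)
    (Rl : Module.End ℝ (SiteY i → 𝔸))
    (hRl : ∀ Λ z, Rl Λ z = -((((etaS i : ℝ)) : ℂ) • cutMulY (hTY i c) (O (cutMulY (hTY i c) (cdsS i V μ Λ))) z))
    (S : Finset (IBondY i)) (hS : ∀ a : IBondY i, β i.hN i.D i.hk a ∈ QT i.D (B9GeoLemma21KLevelV1.one_le_Mh i) (four_le_P' i) c → a ∈ S) :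
    HasMajorant (g := toB6 (geo9K i) Rr Hp) (fun p : SiteY i × ι => ιB (blkOf i.D.toDomains p.1)) (conj b Rl)
      (fun a a' => if a ∈ S then M₂ * (∑ j, ‖b j‖) * (B₀ * (1 + (mN : ℝ) * Real.exp δ * (5 / 8 * C1F d ℓ / i.Mh))) * (geo9K i).len a
          * Real.exp (-(δ * (geo9K i).dist a a'))
        else 0) := by
  classical
  obtain ⟨_, hMh2, _, _⟩ := side_conditions i
  have hM : (0 : ℝ) < i.Mh := by exact_mod_cast (lt_of_lt_of_le (by norm_num) hMh2)
  have hθ : 0 ≤ B₀ * (1 + (mN : ℝ) * Real.exp δ * (5 / 8 * C1F d ℓ / i.Mh)) := by have := C1F_nonneg d ℓ; positivity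
  have hW : ∀ a a' : IBondY i,
      0 ≤ (if a ∈ S then B₀ * (1 + (mN : ℝ) * Real.exp δ * (5 / 8 * C1F d ℓ / i.Mh)) * (geo9K i).len a * Real.exp (-(δ * (geo9K i).dist a a'))
        else 0) := fun a a' => by
    split_ifs
    · exact mul_nonneg (mul_nonneg hθ (B6KLevelCensusIndexV1.len_pos i a).le) (Real.exp_pos _).le
    · exact le_rfl
  have hTW : ∀ (f : SiteY i → ℝ) (y y' : IBondY i), (geo9K i).suppIn (Sum.inl f) y' → ∀ E : 𝔸, ‖E‖ ≤ 1 →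
      ∀ z : SiteY i, blkOf i.D.toDomains z = β i.hN i.D i.hk y → ‖Rl (liftY f E) z‖
        ≤ (if y ∈ S then B₀ * (1 + (mN : ℝ) * Real.exp δ * (5 / 8 * C1F d ℓ / i.Mh)) * (geo9K i).len y * Real.exp (-(δ * (geo9K i).dist y y'))
            else 0) * (geo9K i).supNorm (Sum.inl f) := by
    intro f y y' hs E hE z hz
    rw [hRl, norm_neg, norm_ofReal_smul, abs_of_pos (etaS_pos i)]
    by_cases hy : y ∈ S
    · rw [if_pos hy]
      exact (eta_norm_hOh_cdsS_le i V O c hB₀ hδ hη ιB hι hV h342₀ h342₂ T hT hnbr f y y' hs (liftY f E) (norm_liftY_le f hE) z μ hz).trans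
        (le_of_eq (by ring))
    · have h0 : cutMulY (hTY i c) (O (cutMulY (hTY i c) (cdsS i V μ (liftY f E)))) z = 0 := by
        by_contra hne
        have hmem := (mem_QT_of_cutMulY_ne_zero i c _ z hne).1
        rw [hz] at hmem
        exact hy (hS y hmem)
      rw [h0, norm_zero, mul_zero, if_neg hy, zero_mul]
  have h := OpsYRead342.hasMajorant_conj_of_ball_bound (Rr := Rr) (Hp := Hp) i b Rl (smul_comm_of_eq_div i V O c μ Rl hRl) ιB hι hM₂ hrepr
    (fun a a' => if a ∈ S then B₀ * (1 + (mN : ℝ) * Real.exp δ * (5 / 8 * C1F d ℓ / i.Mh)) * (geo9K i).len a * Real.exp (-(δ * (geo9K i).dist a a'))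
      else 0) hW hTW
  refine hasMajorant_mono (g := toB6 (geo9K i) Rr Hp) _ h fun a a' => le_of_eq ?_
  show M₂ * (∑ j, ‖b j‖) * (if a ∈ S then B₀ * (1 + (mN : ℝ) * Real.exp δ * (5 / 8 * C1F d ℓ / i.Mh)) * (geo9K i).len a
      * Real.exp (-(δ * (geo9K i).dist a a')) else 0) = _
  split_ifs
  · ring
  · rw [mul_zero]

end Majorants

end Literature.MathematicalPhysics.QuantumFieldTheory.Balaban1983to89.B9Thm37CutoffDivTerms

end
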